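/-
Copyright (c) 2026 the pub-hodgecm-mathlib formalisation cell (harness21).  Prover seat hodgecm-mathlib-LH5-p04 (g11), 2026-09-03.  E1 row 56-B3(55-PF) «PLACE-FREE SIBLINGS OF
THE 55-A FILES», file (T-II): Layer II (tame dischargers) of the twin of ★ A-II `UnitaryLatticeTreeHorosphereTransversal` (keeper F0P3a-p03 (g30) 04:09:00Z ∕ «=» on the
2-file cut 04:13:25Z; census `CENSUS-SIGSHEET-B355PF.v1` 4e3d4b85fe811f96).  Layer I (any isometric involution, hypothesis-style) = `UnitaryLatticeTreeHorosphereTransversalOfInvolution`.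
-/
import Literature.NumberTheory.Automorphic.UnitaryLatticeTreeHorosphereTransversalOfInvolution   -- (T-I) (this seat): the twelve `_of_involution` heads; brings (S) `eq_apartmentEnum_sub_one_or_exists_mem_unipotentU_of_adj_of_neg`
import Literature.NumberTheory.Automorphic.UnitaryLatticeTreeFramesOfInvolution                   -- ★ `isTree_latticeGraph_three_of_neg` (the tame-ramified lattice graph is a tree)
import HarnessLib

/-!
# Horospheres of the `U(3)` tree AT A TAMELY RAMIFIED PLACE, unconditionally: `N`-orbits meet the standard apartment exactly once; Borel stabilisers
# (Bruhat–Tits 1972 §10; Tits 1979 §2.4; Serre, *Trees* II.1.1)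

Topic `NumberTheory/Automorphic`; namespace `Literature.NumberTheory.Automorphic.UnitaryLatticeTree`.  THEOREMS ONLY (no definition, no instance, no notation, no named
fact, no `sorry`).  Cell `pub/hodgecm-mathlib` (D-0151), crux H413 = `stmt-HodgeConjecture-24833`, lane `--supports`; E1 BRICK LEDGER row 56-B3(55-PF) (keeper F0P3a-p03
(g30); LEAD T15-42 (iii)): Layer II of the place-free sibling of ★ A-II `UnitaryLatticeTreeHorosphereTransversal`.  At a TAMELY RAMIFIED place — `σ` an isometric
involution (`hσ`, `hvσ`), `ϖ` a uniformiser with `σϖ = −ϖ` (`hϖ`, `hσϖ`), residually trivial `σ` (`hres`), `|2| = 1` (`h2`), first-order norm surjectivity on `σ`-fixed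
one-units (`hnorm`); `[ValuativeRel K]` as in ★ `isTree_latticeGraph_three_of_neg` — the two hypotheses of Layer I are DISCHARGED: `hT` by ★ `isTree_latticeGraph_three_of_neg
hσ hvσ hϖ hσϖ hres h2 hnorm` and `hH4` by (S) `eq_apartmentEnum_sub_one_or_exists_mem_unipotentU_of_adj_of_neg hσ hvσ hϖ hσϖ hres h2`.  Every head below is the ONE-LINE
specialisation of its `_of_involution` form; binders `(hσ hvσ hϖ hσϖ hres h2 hnorm) (A hA0 hA1) ‹rest verbatim›` (the seven letters of ★ `isTree_latticeGraph_three_of_neg`, in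
its order); conclusions VERBATIM = ★ A-II's; names = ★ name + `_of_neg`.  These are the heads the tame twin of the datum file 55-B (`Theorems/F0P3cStCharTSHorocyclesAtDatum`)
calls, by the token pass `hd ↦ hσ hvσ hϖ hσϖ hres h2 hnorm`.  (H8₀) and (H8′) are PLACE-FREE already in Layer I (`…_of_mem_torusU_of_involution`, `…_of_mem_borelU_of_involution
(hσ hvσ hϖ) (A hA0 hA1)`) and need no discharge.  HONEST LABEL: count-neutral generic lattice-tree layer (TAME road GO-LOW, WILD = PRINT; E1 = PRINT); HC_CM is proved only
modulo the 7 printed citations (2 remaining named inputs hLiu418 = `stmt-HodgeConjecture-24832`, h413 = `stmt-HodgeConjecture-24833`) until rung 0 closes; nothing printed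
is asserted here.

WHAT IS FORMALISED.  §1 (H5) `exists_mem_unipotentU_latticeGraphIso_apartmentEnum_eq_of_neg`; §2 (H6) `eq_of_mem_unipotentU_of_latticeGraphIso_apartmentEnum_eq_of_neg`, `…_eq₂_of_neg`,
`existsUnique_apartmentEnum_index_of_neg`; §3 (H7) `…_eq_of_adj_of_neg`, `…sym2Map…_of_adj_of_neg`, `…mapEdgeSet…_of_neg`, uniqueness `…sym2Map…_eq_of_neg`, `…_eq₂_of_neg`,
`…mapEdgeSet…_eq_of_neg`; §4 (H8) `exists_torusU_mul_unipotentU_of_mem_borelU_of_latticeGraphIso_apartmentEnum_eq_of_neg`.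

## References
* [BruhatTits1972] F. Bruhat, J. Tits, *Groupes réductifs sur un corps local I*, Publ. Math. IHÉS 41 (1972), §10 (lattice models of the classical groups), (7.4.18).
* [Tits1979] J. Tits, *Reductive groups over local fields*, Proc. Sympos. Pure Math. 33.1 (1979), §2.4 (the ramified quasi-split `SU₃`: both vertex types special), §3.3.3.
* [Serre1980Trees] J.-P. Serre, *Trees* (1980), Ch. II §1.1, Ch. I §2.2 Prop. 8, Ch. I §6.4.
-/

set_option autoImplicit false

open scoped Valued WithZero Matrix MatrixGroups

namespace Literature.NumberTheory.Automorphic.UnitaryLatticeTree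

open _root_.SimpleGraph Literature.NumberTheory.Automorphic Literature.NumberTheory.Automorphic.HermitianLattice
open Literature.NumberTheory.Automorphic.UnitaryGroup

variable {K : Type*} [Field K] [Valued K ℤᵐ⁰] [ValuativeRel K] [(Valued.v : Valuation K ℤᵐ⁰).Compatible] {σ : K →+* K} {ϖ : K}

/-! ## §1 (H5) EXISTENCE at a tamely ramified place -/

/-- **(H5) AT A TAMELY RAMIFIED PLACE, UNCONDITIONALLY — every vertex is `n · A j`, `n ∈ N`** (`hT` ↦ ★ `isTree_latticeGraph_three_of_neg`, `hH4` ↦ (S) `…_of_adj_of_neg`).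
Conclusion VERBATIM = ★ (H5)'s. [cite: BruhatTits1972, §10] [cite: Tits1979, §2.4] [cite: Serre1980Trees, II.1.1] -/
theorem exists_mem_unipotentU_latticeGraphIso_apartmentEnum_eq_of_neg (hσ : ∀ x, σ (σ x) = x) (hvσ : ∀ a, Valued.v (σ a) = Valued.v a) (hϖ : Valued.v ϖ = WithZero.exp (-1 : ℤ)) (hσϖ : σ ϖ = -ϖ)
    (hres : ∀ x : K, Valued.v x ≤ 1 → Valued.v (σ x - x) < 1) (h2 : Valued.v (2 : K) = 1)
    (hnorm : ∀ u : K, σ u = u → Valued.v (u - 1) < 1 → ∃ z : K, z * σ z = u ∧ Valued.v (z - 1) ≤ Valued.v (u - 1))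
    (A : ℤ → {M : Submodule 𝒪[K] (Fin 3 → K) // IsVertex σ ϖ ((StdForm.antidiagonal 3).over K) M})
    (hA0 : ∀ a : ℤ, (A (2 * a)).1 = latt (Matrix.diagonal ![ϖ ^ a, (1 : K), ϖ ^ (-a)]))
    (hA1 : ∀ a : ℤ, (A (2 * a + 1)).1 = latt (Matrix.diagonal ![ϖ ^ (a + 1), (1 : K), ϖ ^ (-a)]))
    (x : {M : Submodule 𝒪[K] (Fin 3 → K) // IsVertex σ ϖ ((StdForm.antidiagonal 3).over K) M}) :
    ∃ n : unitaryGroupOfForm σ ((StdForm.antidiagonal 3).over K), n ∈ unipotentU σ ((StdForm.antidiagonal 3).over K) ∧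
      ∃ j : ℤ, latticeGraphIso σ ϖ ((StdForm.antidiagonal 3).over K) n (A j) = x :=
  exists_mem_unipotentU_latticeGraphIso_apartmentEnum_eq_of_involution A (isTree_latticeGraph_three_of_neg hσ hvσ hϖ hσϖ hres h2 hnorm)
    (fun j _ hy => eq_apartmentEnum_sub_one_or_exists_mem_unipotentU_of_adj_of_neg hσ hvσ hϖ hσϖ hres h2 A hA0 hA1 j hy) x

/-! ## §2 (H6) UNIQUENESS at a tamely ramified place -/

/-- **(H6) AT A TAMELY RAMIFIED PLACE — `n · A i = A j`, `n ∈ N` ⇒ `i = j`.**  Conclusion VERBATIM = ★ (H6)'s. [cite: BruhatTits1972, §10] [cite: Tits1979, §2.4] [cite: Serre1980Trees, II.1.1] -/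
theorem eq_of_mem_unipotentU_of_latticeGraphIso_apartmentEnum_eq_of_neg (hσ : ∀ x, σ (σ x) = x) (hvσ : ∀ a, Valued.v (σ a) = Valued.v a) (hϖ : Valued.v ϖ = WithZero.exp (-1 : ℤ)) (hσϖ : σ ϖ = -ϖ)
    (hres : ∀ x : K, Valued.v x ≤ 1 → Valued.v (σ x - x) < 1) (h2 : Valued.v (2 : K) = 1)
    (hnorm : ∀ u : K, σ u = u → Valued.v (u - 1) < 1 → ∃ z : K, z * σ z = u ∧ Valued.v (z - 1) ≤ Valued.v (u - 1))
    (A : ℤ → {M : Submodule 𝒪[K] (Fin 3 → K) // IsVertex σ ϖ ((StdForm.antidiagonal 3).over K) M})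
    (hA0 : ∀ a : ℤ, (A (2 * a)).1 = latt (Matrix.diagonal ![ϖ ^ a, (1 : K), ϖ ^ (-a)]))
    (hA1 : ∀ a : ℤ, (A (2 * a + 1)).1 = latt (Matrix.diagonal ![ϖ ^ (a + 1), (1 : K), ϖ ^ (-a)]))
    {n : unitaryGroupOfForm σ ((StdForm.antidiagonal 3).over K)}
    (hn : n ∈ unipotentU σ ((StdForm.antidiagonal 3).over K)) {i j : ℤ} (h : latticeGraphIso σ ϖ ((StdForm.antidiagonal 3).over K) n (A i) = A j) :
    i = j :=
  eq_of_mem_unipotentU_of_latticeGraphIso_apartmentEnum_eq_of_involution hσ hvσ hϖ A hA0 hA1 (isTree_latticeGraph_three_of_neg hσ hvσ hϖ hσϖ hres h2 hnorm) hn h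

/-- **(H6₂) AT A TAMELY RAMIFIED PLACE — two-element form.**  Conclusion VERBATIM = ★'s. [cite: BruhatTits1972, §10] [cite: Tits1979, §2.4] [cite: Serre1980Trees, II.1.1] -/
theorem eq_of_mem_unipotentU_of_latticeGraphIso_apartmentEnum_eq₂_of_neg (hσ : ∀ x, σ (σ x) = x) (hvσ : ∀ a, Valued.v (σ a) = Valued.v a) (hϖ : Valued.v ϖ = WithZero.exp (-1 : ℤ)) (hσϖ : σ ϖ = -ϖ)
    (hres : ∀ x : K, Valued.v x ≤ 1 → Valued.v (σ x - x) < 1) (h2 : Valued.v (2 : K) = 1)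
    (hnorm : ∀ u : K, σ u = u → Valued.v (u - 1) < 1 → ∃ z : K, z * σ z = u ∧ Valued.v (z - 1) ≤ Valued.v (u - 1))
    (A : ℤ → {M : Submodule 𝒪[K] (Fin 3 → K) // IsVertex σ ϖ ((StdForm.antidiagonal 3).over K) M})
    (hA0 : ∀ a : ℤ, (A (2 * a)).1 = latt (Matrix.diagonal ![ϖ ^ a, (1 : K), ϖ ^ (-a)]))
    (hA1 : ∀ a : ℤ, (A (2 * a + 1)).1 = latt (Matrix.diagonal ![ϖ ^ (a + 1), (1 : K), ϖ ^ (-a)]))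
    {n n' : unitaryGroupOfForm σ ((StdForm.antidiagonal 3).over K)}
    (hn : n ∈ unipotentU σ ((StdForm.antidiagonal 3).over K)) (hn' : n' ∈ unipotentU σ ((StdForm.antidiagonal 3).over K)) {i j : ℤ}
    (h : latticeGraphIso σ ϖ ((StdForm.antidiagonal 3).over K) n (A i) = latticeGraphIso σ ϖ ((StdForm.antidiagonal 3).over K) n' (A j)) : i = j :=
  eq_of_mem_unipotentU_of_latticeGraphIso_apartmentEnum_eq₂_of_involution hσ hvσ hϖ A hA0 hA1 (isTree_latticeGraph_three_of_neg hσ hvσ hϖ hσϖ hres h2 hnorm) hn hn' h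

/-- **(H6!) AT A TAMELY RAMIFIED PLACE — THE APARTMENT INDEX (height) OF A VERTEX, UNCONDITIONALLY.**  Conclusion VERBATIM = ★ `existsUnique_apartmentEnum_index`'s. [cite: BruhatTits1972, §10] [cite: Tits1979, §2.4] [cite: Serre1980Trees, II.1.1] -/
theorem existsUnique_apartmentEnum_index_of_neg (hσ : ∀ x, σ (σ x) = x) (hvσ : ∀ a, Valued.v (σ a) = Valued.v a) (hϖ : Valued.v ϖ = WithZero.exp (-1 : ℤ)) (hσϖ : σ ϖ = -ϖ)
    (hres : ∀ x : K, Valued.v x ≤ 1 → Valued.v (σ x - x) < 1) (h2 : Valued.v (2 : K) = 1)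
    (hnorm : ∀ u : K, σ u = u → Valued.v (u - 1) < 1 → ∃ z : K, z * σ z = u ∧ Valued.v (z - 1) ≤ Valued.v (u - 1))
    (A : ℤ → {M : Submodule 𝒪[K] (Fin 3 → K) // IsVertex σ ϖ ((StdForm.antidiagonal 3).over K) M})
    (hA0 : ∀ a : ℤ, (A (2 * a)).1 = latt (Matrix.diagonal ![ϖ ^ a, (1 : K), ϖ ^ (-a)]))
    (hA1 : ∀ a : ℤ, (A (2 * a + 1)).1 = latt (Matrix.diagonal ![ϖ ^ (a + 1), (1 : K), ϖ ^ (-a)]))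
    (x : {M : Submodule 𝒪[K] (Fin 3 → K) // IsVertex σ ϖ ((StdForm.antidiagonal 3).over K) M}) :
    ∃! j : ℤ, ∃ n : unitaryGroupOfForm σ ((StdForm.antidiagonal 3).over K), n ∈ unipotentU σ ((StdForm.antidiagonal 3).over K) ∧
      latticeGraphIso σ ϖ ((StdForm.antidiagonal 3).over K) n (A j) = x :=
  existsUnique_apartmentEnum_index_of_involution hσ hvσ hϖ A hA0 hA1 (isTree_latticeGraph_three_of_neg hσ hvσ hϖ hσϖ hres h2 hnorm)
    (fun j _ hy => eq_apartmentEnum_sub_one_or_exists_mem_unipotentU_of_adj_of_neg hσ hvσ hϖ hσϖ hres h2 A hA0 hA1 j hy) x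

/-! ## §3 (H7) EDGES at a tamely ramified place -/

/-- **(H7) AT A TAMELY RAMIFIED PLACE — every edge is `n · {A j, A (j+1)}`, oriented form, unconditionally.**  Conclusion VERBATIM = ★'s. [cite: BruhatTits1972, §10] [cite: Tits1979, §2.4] [cite: Serre1980Trees, II.1.1] -/
theorem exists_mem_unipotentU_latticeGraphIso_apartmentEnum_eq_of_adj_of_neg (hσ : ∀ x, σ (σ x) = x) (hvσ : ∀ a, Valued.v (σ a) = Valued.v a) (hϖ : Valued.v ϖ = WithZero.exp (-1 : ℤ)) (hσϖ : σ ϖ = -ϖ)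
    (hres : ∀ x : K, Valued.v x ≤ 1 → Valued.v (σ x - x) < 1) (h2 : Valued.v (2 : K) = 1)
    (hnorm : ∀ u : K, σ u = u → Valued.v (u - 1) < 1 → ∃ z : K, z * σ z = u ∧ Valued.v (z - 1) ≤ Valued.v (u - 1))
    (A : ℤ → {M : Submodule 𝒪[K] (Fin 3 → K) // IsVertex σ ϖ ((StdForm.antidiagonal 3).over K) M})
    (hA0 : ∀ a : ℤ, (A (2 * a)).1 = latt (Matrix.diagonal ![ϖ ^ a, (1 : K), ϖ ^ (-a)]))
    (hA1 : ∀ a : ℤ, (A (2 * a + 1)).1 = latt (Matrix.diagonal ![ϖ ^ (a + 1), (1 : K), ϖ ^ (-a)]))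
    {x y : {M : Submodule 𝒪[K] (Fin 3 → K) // IsVertex σ ϖ ((StdForm.antidiagonal 3).over K) M}}
    (hxy : (latticeGraph σ ϖ ((StdForm.antidiagonal 3).over K)).Adj x y) :
    ∃ n : unitaryGroupOfForm σ ((StdForm.antidiagonal 3).over K), n ∈ unipotentU σ ((StdForm.antidiagonal 3).over K) ∧ ∃ j : ℤ,
      (latticeGraphIso σ ϖ ((StdForm.antidiagonal 3).over K) n (A j) = x ∧ latticeGraphIso σ ϖ ((StdForm.antidiagonal 3).over K) n (A (j + 1)) = y) ∨
      (latticeGraphIso σ ϖ ((StdForm.antidiagonal 3).over K) n (A (j + 1)) = x ∧ latticeGraphIso σ ϖ ((StdForm.antidiagonal 3).over K) n (A j) = y) :=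
  exists_mem_unipotentU_latticeGraphIso_apartmentEnum_eq_of_adj_of_involution A (isTree_latticeGraph_three_of_neg hσ hvσ hϖ hσϖ hres h2 hnorm)
    (fun j _ hy => eq_apartmentEnum_sub_one_or_exists_mem_unipotentU_of_adj_of_neg hσ hvσ hϖ hσϖ hres h2 A hA0 hA1 j hy) hxy

/-- **(H7s) AT A TAMELY RAMIFIED PLACE — `Sym2` form, unconditionally.**  Conclusion VERBATIM = ★'s. [cite: BruhatTits1972, §10] [cite: Tits1979, §2.4] [cite: Serre1980Trees, II.1.1] -/
theorem exists_mem_unipotentU_sym2Map_apartmentEnum_eq_of_adj_of_neg (hσ : ∀ x, σ (σ x) = x) (hvσ : ∀ a, Valued.v (σ a) = Valued.v a) (hϖ : Valued.v ϖ = WithZero.exp (-1 : ℤ)) (hσϖ : σ ϖ = -ϖ)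
    (hres : ∀ x : K, Valued.v x ≤ 1 → Valued.v (σ x - x) < 1) (h2 : Valued.v (2 : K) = 1)
    (hnorm : ∀ u : K, σ u = u → Valued.v (u - 1) < 1 → ∃ z : K, z * σ z = u ∧ Valued.v (z - 1) ≤ Valued.v (u - 1))
    (A : ℤ → {M : Submodule 𝒪[K] (Fin 3 → K) // IsVertex σ ϖ ((StdForm.antidiagonal 3).over K) M})
    (hA0 : ∀ a : ℤ, (A (2 * a)).1 = latt (Matrix.diagonal ![ϖ ^ a, (1 : K), ϖ ^ (-a)]))
    (hA1 : ∀ a : ℤ, (A (2 * a + 1)).1 = latt (Matrix.diagonal ![ϖ ^ (a + 1), (1 : K), ϖ ^ (-a)]))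
    {x y : {M : Submodule 𝒪[K] (Fin 3 → K) // IsVertex σ ϖ ((StdForm.antidiagonal 3).over K) M}}
    (hxy : (latticeGraph σ ϖ ((StdForm.antidiagonal 3).over K)).Adj x y) :
    ∃ n : unitaryGroupOfForm σ ((StdForm.antidiagonal 3).over K), n ∈ unipotentU σ ((StdForm.antidiagonal 3).over K) ∧ ∃ j : ℤ,
      Sym2.map (latticeGraphIso σ ϖ ((StdForm.antidiagonal 3).over K) n) s(A j, A (j + 1)) = s(x, y) :=
  exists_mem_unipotentU_sym2Map_apartmentEnum_eq_of_adj_of_involution A (isTree_latticeGraph_three_of_neg hσ hvσ hϖ hσϖ hres h2 hnorm)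
    (fun j _ hy => eq_apartmentEnum_sub_one_or_exists_mem_unipotentU_of_adj_of_neg hσ hvσ hϖ hσϖ hres h2 A hA0 hA1 j hy) hxy

/-- **(H7e) AT A TAMELY RAMIFIED PLACE — `edgeSet` form, unconditionally** (certificate by ★ B1's `…_succ_of_involution`, proof-irrelevant).  Conclusion VERBATIM = ★'s. [cite: BruhatTits1972, §10] [cite: Tits1979, §2.4] [cite: Serre1980Trees, II.1.1] -/
theorem exists_mem_unipotentU_mapEdgeSet_apartmentEnum_eq_of_neg (hσ : ∀ x, σ (σ x) = x) (hvσ : ∀ a, Valued.v (σ a) = Valued.v a) (hϖ : Valued.v ϖ = WithZero.exp (-1 : ℤ)) (hσϖ : σ ϖ = -ϖ)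
    (hres : ∀ x : K, Valued.v x ≤ 1 → Valued.v (σ x - x) < 1) (h2 : Valued.v (2 : K) = 1)
    (hnorm : ∀ u : K, σ u = u → Valued.v (u - 1) < 1 → ∃ z : K, z * σ z = u ∧ Valued.v (z - 1) ≤ Valued.v (u - 1))
    (A : ℤ → {M : Submodule 𝒪[K] (Fin 3 → K) // IsVertex σ ϖ ((StdForm.antidiagonal 3).over K) M})
    (hA0 : ∀ a : ℤ, (A (2 * a)).1 = latt (Matrix.diagonal ![ϖ ^ a, (1 : K), ϖ ^ (-a)]))
    (hA1 : ∀ a : ℤ, (A (2 * a + 1)).1 = latt (Matrix.diagonal ![ϖ ^ (a + 1), (1 : K), ϖ ^ (-a)]))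
    (e : (latticeGraph σ ϖ ((StdForm.antidiagonal 3).over K)).edgeSet) :
    ∃ n : unitaryGroupOfForm σ ((StdForm.antidiagonal 3).over K), n ∈ unipotentU σ ((StdForm.antidiagonal 3).over K) ∧ ∃ j : ℤ,
      (latticeGraphIso σ ϖ ((StdForm.antidiagonal 3).over K) n).mapEdgeSet
          ⟨s(A j, A (j + 1)), (mem_edgeSet _).2 (latticeGraph_adj_apartmentEnum_succ_of_involution hσ hvσ hϖ A hA0 hA1 j)⟩ = e :=
  exists_mem_unipotentU_mapEdgeSet_apartmentEnum_eq_of_involution hσ hvσ hϖ A hA0 hA1 (isTree_latticeGraph_three_of_neg hσ hvσ hϖ hσϖ hres h2 hnorm)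
    (fun j _ hy => eq_apartmentEnum_sub_one_or_exists_mem_unipotentU_of_adj_of_neg hσ hvσ hϖ hσϖ hres h2 A hA0 hA1 j hy) e

/-- **(H7!) AT A TAMELY RAMIFIED PLACE — the apartment index of an edge is well defined.**  Conclusion VERBATIM = ★'s. [cite: BruhatTits1972, §10] [cite: Tits1979, §2.4] [cite: Serre1980Trees, II.1.1] -/
theorem eq_of_mem_unipotentU_of_sym2Map_apartmentEnum_eq_of_neg (hσ : ∀ x, σ (σ x) = x) (hvσ : ∀ a, Valued.v (σ a) = Valued.v a) (hϖ : Valued.v ϖ = WithZero.exp (-1 : ℤ)) (hσϖ : σ ϖ = -ϖ)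
    (hres : ∀ x : K, Valued.v x ≤ 1 → Valued.v (σ x - x) < 1) (h2 : Valued.v (2 : K) = 1)
    (hnorm : ∀ u : K, σ u = u → Valued.v (u - 1) < 1 → ∃ z : K, z * σ z = u ∧ Valued.v (z - 1) ≤ Valued.v (u - 1))
    (A : ℤ → {M : Submodule 𝒪[K] (Fin 3 → K) // IsVertex σ ϖ ((StdForm.antidiagonal 3).over K) M})
    (hA0 : ∀ a : ℤ, (A (2 * a)).1 = latt (Matrix.diagonal ![ϖ ^ a, (1 : K), ϖ ^ (-a)]))
    (hA1 : ∀ a : ℤ, (A (2 * a + 1)).1 = latt (Matrix.diagonal ![ϖ ^ (a + 1), (1 : K), ϖ ^ (-a)]))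
    {n : unitaryGroupOfForm σ ((StdForm.antidiagonal 3).over K)}
    (hn : n ∈ unipotentU σ ((StdForm.antidiagonal 3).over K)) {i j : ℤ}
    (h : Sym2.map (latticeGraphIso σ ϖ ((StdForm.antidiagonal 3).over K) n) s(A i, A (i + 1)) = s(A j, A (j + 1))) : i = j :=
  eq_of_mem_unipotentU_of_sym2Map_apartmentEnum_eq_of_involution hσ hvσ hϖ A hA0 hA1 (isTree_latticeGraph_three_of_neg hσ hvσ hϖ hσϖ hres h2 hnorm) hn h

/-- **(H7!₂) AT A TAMELY RAMIFIED PLACE — two-element form.**  Conclusion VERBATIM = ★'s. [cite: BruhatTits1972, §10] [cite: Tits1979, §2.4] [cite: Serre1980Trees, II.1.1] -/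
theorem eq_of_mem_unipotentU_of_sym2Map_apartmentEnum_eq₂_of_neg (hσ : ∀ x, σ (σ x) = x) (hvσ : ∀ a, Valued.v (σ a) = Valued.v a) (hϖ : Valued.v ϖ = WithZero.exp (-1 : ℤ)) (hσϖ : σ ϖ = -ϖ)
    (hres : ∀ x : K, Valued.v x ≤ 1 → Valued.v (σ x - x) < 1) (h2 : Valued.v (2 : K) = 1)
    (hnorm : ∀ u : K, σ u = u → Valued.v (u - 1) < 1 → ∃ z : K, z * σ z = u ∧ Valued.v (z - 1) ≤ Valued.v (u - 1))
    (A : ℤ → {M : Submodule 𝒪[K] (Fin 3 → K) // IsVertex σ ϖ ((StdForm.antidiagonal 3).over K) M})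
    (hA0 : ∀ a : ℤ, (A (2 * a)).1 = latt (Matrix.diagonal ![ϖ ^ a, (1 : K), ϖ ^ (-a)]))
    (hA1 : ∀ a : ℤ, (A (2 * a + 1)).1 = latt (Matrix.diagonal ![ϖ ^ (a + 1), (1 : K), ϖ ^ (-a)]))
    {n n' : unitaryGroupOfForm σ ((StdForm.antidiagonal 3).over K)}
    (hn : n ∈ unipotentU σ ((StdForm.antidiagonal 3).over K)) (hn' : n' ∈ unipotentU σ ((StdForm.antidiagonal 3).over K)) {i j : ℤ}
    (h : Sym2.map (latticeGraphIso σ ϖ ((StdForm.antidiagonal 3).over K) n) s(A i, A (i + 1)) =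
      Sym2.map (latticeGraphIso σ ϖ ((StdForm.antidiagonal 3).over K) n') s(A j, A (j + 1))) : i = j :=
  eq_of_mem_unipotentU_of_sym2Map_apartmentEnum_eq₂_of_involution hσ hvσ hϖ A hA0 hA1 (isTree_latticeGraph_three_of_neg hσ hvσ hϖ hσϖ hres h2 hnorm) hn hn' h

/-- **(H7!e) AT A TAMELY RAMIFIED PLACE — `edgeSet` form of the uniqueness.**  Conclusion VERBATIM = ★'s. [cite: BruhatTits1972, §10] [cite: Tits1979, §2.4] [cite: Serre1980Trees, II.1.1] -/
theorem eq_of_mem_unipotentU_of_mapEdgeSet_apartmentEnum_eq_of_neg (hσ : ∀ x, σ (σ x) = x) (hvσ : ∀ a, Valued.v (σ a) = Valued.v a) (hϖ : Valued.v ϖ = WithZero.exp (-1 : ℤ)) (hσϖ : σ ϖ = -ϖ)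
    (hres : ∀ x : K, Valued.v x ≤ 1 → Valued.v (σ x - x) < 1) (h2 : Valued.v (2 : K) = 1)
    (hnorm : ∀ u : K, σ u = u → Valued.v (u - 1) < 1 → ∃ z : K, z * σ z = u ∧ Valued.v (z - 1) ≤ Valued.v (u - 1))
    (A : ℤ → {M : Submodule 𝒪[K] (Fin 3 → K) // IsVertex σ ϖ ((StdForm.antidiagonal 3).over K) M})
    (hA0 : ∀ a : ℤ, (A (2 * a)).1 = latt (Matrix.diagonal ![ϖ ^ a, (1 : K), ϖ ^ (-a)]))
    (hA1 : ∀ a : ℤ, (A (2 * a + 1)).1 = latt (Matrix.diagonal ![ϖ ^ (a + 1), (1 : K), ϖ ^ (-a)]))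
    {n n' : unitaryGroupOfForm σ ((StdForm.antidiagonal 3).over K)}
    (hn : n ∈ unipotentU σ ((StdForm.antidiagonal 3).over K)) (hn' : n' ∈ unipotentU σ ((StdForm.antidiagonal 3).over K)) {i j : ℤ}
    (h : (latticeGraphIso σ ϖ ((StdForm.antidiagonal 3).over K) n).mapEdgeSet
        ⟨s(A i, A (i + 1)), (mem_edgeSet _).2 (latticeGraph_adj_apartmentEnum_succ_of_involution hσ hvσ hϖ A hA0 hA1 i)⟩ =
      (latticeGraphIso σ ϖ ((StdForm.antidiagonal 3).over K) n').mapEdgeSet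
        ⟨s(A j, A (j + 1)), (mem_edgeSet _).2 (latticeGraph_adj_apartmentEnum_succ_of_involution hσ hvσ hϖ A hA0 hA1 j)⟩) : i = j :=
  eq_of_mem_unipotentU_of_mapEdgeSet_apartmentEnum_eq_of_involution hσ hvσ hϖ A hA0 hA1 (isTree_latticeGraph_three_of_neg hσ hvσ hϖ hσϖ hres h2 hnorm) hn hn' h

/-! ## §4 (H8) BOREL STABILISERS at a tamely ramified place -/

/-- **(H8) AT A TAMELY RAMIFIED PLACE — BOREL STABILISERS `B ∩ Stab(A j) = C · (N ∩ Stab(A j))`, UNCONDITIONALLY.**  Conclusion VERBATIM = ★'s.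
[cite: BruhatTits1972, §10] [cite: Tits1979, §2.4] [cite: Serre1980Trees, II.1.1; I.6.4] -/
theorem exists_torusU_mul_unipotentU_of_mem_borelU_of_latticeGraphIso_apartmentEnum_eq_of_neg (hσ : ∀ x, σ (σ x) = x) (hvσ : ∀ a, Valued.v (σ a) = Valued.v a) (hϖ : Valued.v ϖ = WithZero.exp (-1 : ℤ)) (hσϖ : σ ϖ = -ϖ)
    (hres : ∀ x : K, Valued.v x ≤ 1 → Valued.v (σ x - x) < 1) (h2 : Valued.v (2 : K) = 1)
    (hnorm : ∀ u : K, σ u = u → Valued.v (u - 1) < 1 → ∃ z : K, z * σ z = u ∧ Valued.v (z - 1) ≤ Valued.v (u - 1))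
    (A : ℤ → {M : Submodule 𝒪[K] (Fin 3 → K) // IsVertex σ ϖ ((StdForm.antidiagonal 3).over K) M})
    (hA0 : ∀ a : ℤ, (A (2 * a)).1 = latt (Matrix.diagonal ![ϖ ^ a, (1 : K), ϖ ^ (-a)]))
    (hA1 : ∀ a : ℤ, (A (2 * a + 1)).1 = latt (Matrix.diagonal ![ϖ ^ (a + 1), (1 : K), ϖ ^ (-a)]))
    {b : unitaryGroupOfForm σ ((StdForm.antidiagonal 3).over K)}
    (hb : b ∈ borelU σ ((StdForm.antidiagonal 3).over K)) {j : ℤ} (h : latticeGraphIso σ ϖ ((StdForm.antidiagonal 3).over K) b (A j) = A j) :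
    ∃ t n : unitaryGroupOfForm σ ((StdForm.antidiagonal 3).over K), t ∈ torusU σ ((StdForm.antidiagonal 3).over K) ∧
      t ∈ unitaryInt σ ((StdForm.antidiagonal 3).over K) ∧
      n ∈ unipotentU σ ((StdForm.antidiagonal 3).over K) ∧ b = t * n ∧
      (∃ d : Fin 3 → Kˣ, glDiagonal 3 K d = (t : GL (Fin 3) K) ∧ ∀ i, Valued.v (d i : K) = 1) ∧
      (∀ k : ℤ, latticeGraphIso σ ϖ ((StdForm.antidiagonal 3).over K) t (A k) = A k) ∧
      latticeGraphIso σ ϖ ((StdForm.antidiagonal 3).over K) n (A j) = A j :=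
  exists_torusU_mul_unipotentU_of_mem_borelU_of_latticeGraphIso_apartmentEnum_eq_of_involution hσ hvσ hϖ A hA0 hA1 (isTree_latticeGraph_three_of_neg hσ hvσ hϖ hσϖ hres h2 hnorm) hb h

end Literature.NumberTheory.Automorphic.UnitaryLatticeTree
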